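/-
Copyright: the b2b-balaban cell (near-miss cell 7), T⁴-continuum fan-out; row NE7b ROUND-2 swarm, seat
t4-ne7b-formalise-leaf-09 (gen 12), filed at the owner's request R-OWNER-24-1 (D) ∕ GO R-OWNER-24-2 (A) (journal l.20113 ∕ l.20171; row LI) at the
typer's direction, from the typer's mirror `t4/formal/NE7b/{DAG,LEAVES}.md` v2.52.  Released under the licence of the surrounding project.
-/
import Summits.QuantumFields.BalabanUV.T4Continuum.Support.HistoryRealiseCellsRunHeadlineT3bP
import Summits.QuantumFields.BalabanUV.T4Continuum.Support.HistoryChessboardHeadline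
import Summits.QuantumFields.BalabanUV.T4Continuum.Support.HistoryRealiseCellsRunHeadlineT3bPc
import Summits.QuantumFields.BalabanUV.T4Continuum.Support.HistoryRealiseCellsRunWindowT3bPc
import Summits.QuantumFields.BalabanUV.T4Continuum.Support.HistoryRealiseCellsRunWindowT3bPTwin
import Literature.MathematicalPhysics.QuantumFieldTheory.Balaban1983to89.T4BadClassBooking
-- v1.1 (gen 13, APPEND-ONLY): the last two items of the FINAL in-flight set (R-OWNER-24-3), landed after v1
import Summits.QuantumFields.BalabanUV.T4Continuum.Support.HistoryRealiseCellsRunWindowT3bPcPayRoot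
import Summits.QuantumFields.BalabanUV.T4Continuum.Support.HistoryChessboardPlaquetteReaderBonds

/-!
# `T4Continuum.Spine.NE7b.LeafIndex` — row NE7b (node U5c), route «COUNT» (+ the secondary road W-RP): the TYPER's LEAF
# INDEX as ONE import apex of the row's kernel chain (bookkeeping only: NAME CHECKS + three named junctions; no definition)

Cell `pub-balaban`, sub-cell `t4`, spine estimate NE7b; owner lineage `b2b-balaban-t4-ne7b-p1` (claim table
`t4/b2b-balaban-t4-ne7b-p1/LEAVES-NE7b.md` v3.68), typer `b2b-balaban-t4-ne7b-formalise-typer` (mirror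
`t4/formal/NE7b/DAG.md` ∕ `LEAVES.md` v2.52, 70 nodes), trigger `t4/T4-NE7b-TRIGGER.json` c1–c6.  This module IMPORTS EXACTLY
the headline of record (p224237), the W-road headline (p225792), the concave re-proof (p231379 ∕ v1.1 p232442), the
displayed coupling window (p232166) and its Θ₀-uniform twin (p233632), and the Literature negatives `T4BadClassBooking`
(`T4PersistentHistoryCount` is already in the cone through the count exit), so that ONE build target elaborates the
row's composition spine; it re-states nothing and proves nothing (every `example` below is `example := @<name>` — a NAME
CHECK that the declaration exists under that name at tree head — no `#check`), plus §3: three JUNCTIONS OF RECORD as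
NAMED statements (the window END ⇒ the pinned END of record; the Θ₀-uniform window END ⇒ the Θ₀-uniform pinned twin;
the two by-name headlines jointly) — new implications ∕ a conjunction between the tree's own Props, composed BY NAME
(the two implications are p232166 §2's and p233632 (F1)'s fidelity `example`s given names); 0 `def`, 0 `[cite:]`,
0 sorry, no statement of any landed theorem re-declared.  MODULE-MAP import direction: this file is a POST-APEX LEAF — it is imported by NO module and must stay so
(nothing downstream may depend on an index); the tree-free census numerals `HistoryThetaConcaveNumerals` (p228231 ∕
p230007) and `HistoryWindowNumerals` (p233003) are deliberately NOT imported (they stay tree-free, trigger c6) and are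
named in §1 only.

**v1.1 (seat t4-ne7b-formalise-leaf-09 gen 13, APPEND-ONLY over v1 = p234616; doc ∕ import-repair class, R-OWNER-24-2 (D);
typer spec `t4/formal/NE7b/Statements/LeafIndex-section0.v1.1.md` PART B.2 «a later APPEND-ONLY may add name checks»;
INTENT journal l.20905).**  The FINAL in-flight set of the closed claim table (R-OWNER-24-3) landed IN FULL after the
v1 import list was fixed: row S12r «THE INFRARED FACTOR DISPLAYED» (leaf-08 gen 13; (A) p234299 ∕ (B) p234727 ∕ (C) p235130,
typer test (ζ) OF RECORD PASS 5∕5, mirror v2.55) and road W-RP sub-row «W-LAB» file 11 (leaf-06 gen 8; 11a p233622 ∕ 11b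
p234088 ∕ 11c p234543, (δ-a∕b∕c) PASS).  v1.1 imports EXACTLY TWO more landed modules — S12r (C) (cone: (A), (B)) and
W-LAB 11c (cone: 11a, 11b, W-LAB 10 `HistoryChessboardSmallFieldReader`) — so that the one apex build target elaborates
the row's COMPLETE final set; §0 gains their two rows; §4 (appended; every code byte of §2–§3 unchanged) = their NAME
CHECKS + ONE junction of §3's exact kind, `pinned_of_windowPayRoot` (S12r's EXPLICIT-threshold window END ⇒ the pinned
END of record p224056, by the same λ-term as `pinned_of_window` — the two window STATEMENTS differ in exactly one token,
`irThresholdTLE ↦ payThresholdRoot` inside the window's first factor, binder lists identical; the two WINDOWS themselves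
stay incomparable in the kernel, as (C)'s docstring says).  Still 0 `def`, 0 `[cite:]`, 0 sorry; still a POST-APEX LEAF.

HONEST FRAMING (trigger c4, verbatim class).  Rung (B)+1 on a FINITE torus T⁴ — NOT infinite volume, NOT the mass gap,
NOT the Clay statement.  NE7b (`T4WeightBudget.RelWeightBound`, the persistent-activity relative weight bound of the
old-pending large-field classes, two tuned runs) is NOT PRINTED in [Bałaban 1983–89] and NOT PROVED.  What the tree
holds is «the COUNT route reduced to H3 + (B) + BetaPertH-flow + NE7c socket + NE7 core budget, DISPLAYED»: the
headline of record `HistoryRealiseCellsRunHeadlineT3bP.continuumYM4Torus_of_countRoadT3bP_fsc` (p224237) concludes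
`ContinuumYM4Torus D` from (B) `B16.EndStatementBPrinted` BY NAME ∧ `BetaPertHyp` BY NAME ∧ a constants side ∧
`ForSmallCouplings`[a `CountRoadWitnessT3b` per loop string] — whose fields are the class-R READING binders of H3
(`reprA reprB`, `RealisedDomainsR`, `cost_le`, the price sentence `price price'`, `resumM`), the (B)-side data, NE7c's
`ShellWeightBound`, NE7's `ReindexedBudget`, the four summable rates (wall certificate `WALL-NE7b-P1.md` v1.10 §2).
Nothing of H3 ∕ (B) ∕ BetaPertHyp ∕ NE7c ∕ NE7 ∕ rates is discharged anywhere in this row.  Spine PROVED 0∕9.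
HONEST DEPENDENCY: continuum YM on T⁴ ⇐ BetaPertH ∧ nine spine estimates (0/9 proved); BetaPertH ⇐ (D1) ∧ (D4) ∧
CAP+tail; G-an2-4 gates asym, D1 and NE2/3/4.

## §0 LEAF INDEX (typer DAG node (owner row) ↦ tree modules `Support/<Module>.lean`, ns `Summit.QuantumFields.BalabanUV.
## T4Continuum.<Module>` ↦ gate ids; generated BY SCRIPT by merging the node table of `t4/formal/NE7b/DAG.md` v2.52 with
## the row table of `t4/formal/NE7b/LEAVES.md` v2.52 — 293 of the 310 `History*`∕`Count*` modules in the tree attached to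
## a node, the 17 others listed last; per-node statements, acceptance tests and XREAD verdicts are in those two files)
* F (S8): `HistoryFlow` — p207273
* G (S11): `HistoryRegeneration` `HistoryAdmissible` — p207294 p207789 p208365
* H1a (S1): `HistoryAdmissible` — p207789 p208365
* H1a″ (S2): `HistoryAdmissibleSanity` — p208178
* H1b′ (S1b): `HistoryWindows` `HistoryRealise` `HistoryRealiseTimed` `HistoryRealiseWitness` `HistoryRealisePedigree`
  — p208941 p209120 p209488 p209817 p209699
* H1c (S1c): `HistoryRealise` `HistorySiblingEntropyCanon` `HistorySiblingEntropyListing` `HistoryTreeShapeLE`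
  `HistoryJoinsSortTwinWt` `HistorySiblingEntropySortPhys` `HistoryRealiseDistinct` `HistoryRealiseDistinctValue`
  `HistoryJoinsPlacedValue` `HistorySiblingEntropySortTwin` `HistorySiblingEntropySortInv` `HistoryJoinsAdm`
  `HistoryTouchIndex` — p215321 p215475 p216025 p215749 p216266 p216337 p216494 p217313 p218898 p219789 p220010
* H2a (S3): `HistoryChain` `HistoryGen` `HistoryGenFresh` `HistoryGenTimed` `HistoryGenBridge` `HistoryGenAdm`
  `HistoryGenOrder` `HistoryGenForest` — p207886 p208087 p208292 p208585 p208871 p209378 p209928 p209036 p210221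
* H2b (S4): `HistoryConsistent` — p207787 p208401
* H2b′ (S4c): `HistoryBankingLE` `HistoryBankingLEInduction` `HistoryTreeShapeLE` `HistoryCanonLE` `HistoryExitLE`
  `HistoryGenTimedLE` `HistoryAssemblyTreesLE` `HistoryAssemblyTermsLE` `HistorySocketTHLE` — p208293 p208514 p208740
  p208809 p208972 p209324 p210307 p210558 p210582
* H2c (S5): `HistoryChrono` `HistoryChronoAdmissible` `HistoryChronoCanon` `HistoryCaps` — p207606 p208211 p208428
  p207780 p208745 p208903
* H2c‴ (S5+): `HistoryCaps` — p208903
* H2d (S6): `HistoryZones` `HistoryZonesTagged` `HistoryShapeCrowd` `HistoryShapeZones` `HistoryShapeRegions`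
  `HistoryZonesTolerant` `HistoryZonesOrbit` `HistoryZoneMass` `HistoryZonesOrbitPlace` `HistoryGenBridge` — p212529
  p212490 p212824 p213069 p213206 p207713 p209144 p208404 p208679 p208840 p209509 p208111
* H2d′ (S6e): `HistoryZoneSurcharge` `HistoryCrowdingTagged` `HistoryZoneSurchargeTagged`
  `HistoryZoneSurchargeShapeFree` `HistorySocketZTH` `HistoryZoneSurchargeLE` — p209960 p208647 p209135 p209520
  p211098
* H2d″ (S6f): `HistoryLevels` `HistoryLevelsTorus` `HistoryZonesDrops` `HistoryZonesDropsRegions` `HistoryLevelsFlow`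
  — p209950 p210161 p210523 p211103 p211205
* H2d‴ (S6g′): `HistorySiblingMass` `HistoryMassPlacement` `HistoryMassPlacementTorus` `HistoryMassPlacementLevels`
  `HistoryJoinsTotal` `HistorySiblingMassLayered` `HistoryJoinsClass` `HistoryZoneMassJoins` `HistoryJoinsBudget`
  `HistorySiblingEntropy` `HistoryJoinsSortTwinWt` `HistoryJoinsNonhost` `HistoryJoinsRadius`
  `HistorySiblingCanonExist` `HistoryJoinsTemplates` `HistoryJoinsPlaced` `HistoryJoinsPlacedEnd`
  `HistoryJoinsPlacedZone` `HistoryJoinsPlacedLaws` `HistoryJoinsPlacedTwin` `HistoryJoinsGlue`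
  `HistoryJoinsPlacedTagged` `HistoryJoinsRearrange` `HistoryZoneMassCluster` `HistoryZoneMassPiecesLaw`
  `HistoryJoinsEntropyBudget` `HistoryZoneMassLaw` `HistoryJoinsRoots` `HistoryZoneMass` `HistoryZonesDropsRegions`
  `HistoryZoneEvolveLevels` `HistoryZoneMassLawLevels` `HistoryJoinsPlacedZoneRead` `HistoryJoinsPlacedValue`
  `HistoryJoinsPlacedPhys` `HistoryJoinsPlacedContact` `HistoryJoinsPlacedMult` `HistoryMemberPlacement`
  `HistoryMemberPlacementRead` `HistoryMemberPlacementParts` `HistoryJoinsClusterContact`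
  `HistoryRealiseCellsRunMultEnd` `HistoryMemberClusterConn` `HistoryJoinsPlacedMember` `HistoryZoneMassTotalFlat`
  `HistoryMemberClusterConnNE` `HistoryAssemblyMultLetters` `HistoryAssemblyMultInstance`
  `HistoryRealiseCellsRunMultEndD` `HistorySiblingSymmetry` `HistoryZoneEvolve` `HistoryJoins` `HistoryZoneMassTotal`
  `HistoryZoneMassRegions` `HistoryZoneMassDating` `HistoryZoneMassDatingGen` `HistorySiblingEntropyShapes`
  `HistoryZoneMassPieces` `HistoryZoneMassBridge` `HistoryZoneMassTotalGen` `HistorySiblingEntropyBridge`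
  `HistoryJoinsTag` `HistorySiblingEntropySorted` `HistoryJoinsEnd` `HistorySiblingEntropyCanon` `HistoryJoinsSup`
  `HistoryRenewalsCost` `HistoryJoinsSupTorus` `HistorySiblingEntropySortTwin` `HistoryJoinsSortTwin`
  `HistorySiblingEntropyGenT` `HistoryRegionTemplates` `HistoryBirthMenus` `HistorySiblingCanon` `HistoryJoinsSupEnd`
  `HistorySiblingOrbits` `HistorySiblingDecay` `HistoryJoinsAdm` `HistoryJoinsCount` `HistorySiblingEntropyJfac`
  `HistoryRenewalsCostFlat` `HistoryRenewalsCostCanon` `HistoryJoinsSupExtent` `HistorySiblingEntropyBound`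
  `HistorySiblingEntropyJoins` `HistorySiblingEntropyDischarge` `HistorySiblingEntropyRenew`
  `HistorySiblingEntropyListing` `HistoryRealise` `HistoryRealiseCellsRunMultEndP`
  `HistoryRealiseCellsRunHeadlineT3bP` — p210054 p211507 p211747 p211932 p211769 p211703 p211905 p212035 p212243
  p212537 p212774 p213046 p213214 p213423 p213578 p213994 p214234 p214290 p213965 p215315 p214368 p215447 p215609
  p215928 p215579 p215587 p216048 p215786 p216215 p214316 p216884 p217019 p217014 p217000 p217172 p217178 p217279
  p217313 p217344 p217881 p218357 p218935 p218978 p219029 p217345 p216795 p216337 p214865 p214544 p214442 p215446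
  p215269 p215104 p213070 p213382 p213527 p213890 p214139 p214658 p214303 p214808 p212322 p212708 p212899 p213334
  p213501 p213826 p214091 p213764 p214018 p213924 p214066 p214791 p214805 p215098 p215198 p215321 p215475 p216025
  p219094 p219354 p219103 p219311 p219459 p219578 p219651 p219915 p219727 p219868 p219883 p220236 p220403 p220132
  p220308 p220726 p220790 p219539 p222172 p221213 p222385 p221097 p223544 p223694 p224237 p216266 p216494 p213198
  p210365 p224056
* H2e (S7): `HistorySocketTH` `HistorySocketTHTuned` `HistorySlots` `HistorySocketZTH` `HistorySocketTHShapeFree`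
  `HistoryCaps` `HistorySocketTHLE` `HistorySocketTHLETuned` `HistoryZoneSurchargeTagged` — p208411 p208692 p208620
  p209193 p209649 p210582 p210887 p209520
* P3a (S9): `HistoryConstants` `HistoryConstantsBridge` — p207777 p208175
* P3a′ (S9b): `HistoryConstantsTH` `HistoryConstantsTHSocket` — p208521 p208807
* P3a″ (S9c): `HistoryConstantsSlack` `HistoryConstantsConnector` — p209081 p209476
* P3b (S10): `HistoryConstantsExist` `HistoryConstantsExistTH` — p207685 p207928 p208727
* A12-T (S12 §1–§5): `HistoryTables` `HistoryAssemblyTrees` `HistoryAssemblySocketTH` `HistoryAssemblyTerms`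
  `HistoryAssemblyZone` `HistoryAssemblyShapeFreeEnd` `HistoryAssemblyShapeFree` `HistoryRealiseCells`
  `HistoryRealiseCellsEnd` `HistoryRealiseCellsRun` `HistoryAssemblyRealiseRun` `HistoryAssemblyRealiseRunEnd`
  `HistoryAssemblyRealiseRunClamp` `HistoryZoneSurcharge` `HistoryAssemblyZoneLE` `HistoryAssemblyRealisePrice`
  `HistoryRealiseCellsRunEnd` `HistoryRealiseCellsWitness` `HistoryAssemblyRealiseRunSlack` `HistoryTransversal`
  `HistoryAssemblyMult` `HistoryAssemblyMultRealise` `HistoryAssemblyRealiseMult` `HistoryAssemblyRealiseRunMult`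
  `HistoryRealiseCellsRunMult` `HistoryRealiseCellsRunSlack` `HistoryHybridRescale` `HistoryRealiseCellsRunApex`
  `HistoryAssemblyMultKey` `HistoryJoinsPlacedMult` `HistoryMemberPlacement` `HistoryRealiseCellsRunMultEnd` — p208749
  p207678 p208180 p208882 p208681 p209052 p210176 p209945 p210803 p210969 p211461 p211546 p211801 p211882 p211994
  p212127 p212383 p216713 p211561 p216884 p212140 p212248 p216885 p216751 p217139 p217655 p217406 p218189 p218753
  p218783 p219242 p218885 p219114 p219010 p219539 p219408 p219578 p222172 p222385 p223402 p219850 p223544 p223694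
  p224237
* A12-I.1 (S12 END, pedigree form): `HistoryAssemblyPedigree` `HistoryCaps` — —
* A12-I.2 (S12∕S12b): `HistoryAssemblyRealiseLE` `HistoryAssemblyPedigreeLE` `HistoryAssemblyTermsLE`
  `HistoryAssemblyTreesLE` `HistoryAssemblyRealise` `HistoryRealiseCells` `HistoryRealiseCellsEnd`
  `HistoryRealiseCellsRun` `HistoryRealiseCellsRunEnd` `HistoryRealiseCellsWitness` `HistoryAssemblyRealiseRun`
  `HistoryAssemblyRealiseRunEnd` `HistoryAssemblyRealiseRunClamp` `HistoryAssemblyZone` `HistoryLevelsFlow`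
  `HistoryCaps` — p210803 p210854 p210595 p210307 p211461 p211546 p211801 p211882 p212140 p216885 p216751 p210969
  p212248 p212127 p211994 p212383 p211564
* A12-I.3 ∕ A12-I.3′ (S12 END, printed price): `HistoryAssemblyPrice` `HistoryAssemblyRealisePrice` — p209732 p210969
  p216884 p217139 p218136
* A12-I.Z (S12 END, zone twin): `HistoryAssemblyZoneLE` `HistoryAssemblyZone` — p216713 p211561 p216884
* A12-I.M (S12e END, multiplicity form): `HistoryAssemblyMult` `HistoryAssemblyMultRealise`
  `HistoryAssemblyRealiseMult` `HistoryAssemblyRealiseRunMult` `HistoryRealiseCellsRunMult`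
  `HistoryRealiseCellsRunMultEnd` `HistoryAssemblyMultInstance` `HistoryRealiseCellsRunMultEndD` — p217655 p222172
  p221213 p220790 p222385 p219539 p221097 p216885
* A12-I.M′ (S12j): `HistoryAssemblyMultProfile` `HistoryAssemblyRealiseRunMultP` `HistoryRealiseCellsRunMultP`
  `HistoryRealiseCellsRunMultEndP` `HistoryRealiseCellsRunMultEndPD` `HistoryConstantsSlackT3bP`
  `HistoryFlowProfileLevel` `HistoryAssemblyMult` `HistoryAssemblyRealiseMult` `HistoryAssemblyRealiseRunMult`
  `HistoryRealiseCellsRunMult` `HistoryRealiseCellsRunMultEnd` — p223044 p223263 p223419 p223544 p223694 p219408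
  p223575 p223753 p223186 p224056 p224237
* A12-I.Mc (F-leaf08g7-1 CONSTANTS-SIDE): `HistoryConstantsSlackT3b` `HistoryConstantsSlackT3bP` — p223209 p223575
  p223753
* A12-I.Me (S12j): `HistoryFlowProfileLevel` — p223186
* A12-I.P (S12f PINNED END): `HistoryRealiseCellsRunPinned` `HistoryRealiseCellsRunEnd` `HistoryFlow` — p218146
* A12-I.X (S12g APEX): `HistoryHybridRescale` `HistoryRealiseCellsRunApex` `HistoryRealiseCellsRunHeadline`
  `HistoryRealiseCellsRunWindow` `HistoryRealiseCellsRunApexWitness` `HistoryRealiseCellsRunWindowIff` — p218783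
  p219284 p218972 p219461 p219722 p219850 p220998
* A12-I.W (S12h): `HistoryRealiseCellsRunApexWitness` `HistoryRealiseCellsRunApex`
  `HistoryRealiseCellsRunApexWitnessData` — p220350 p220641 p220791
* A12-I.X3 (S12i): `HistoryRealiseCellsRunPinnedT3b` `HistoryRealiseCellsRunApexT3b`
  `HistoryRealiseCellsRunHeadlineT3b` `HistoryRealiseCellsRunApexWitnessT3b` `HistoryRealiseCellsRunPinnedT3bP`
  `HistoryRealiseCellsRunHeadlineT3bP` — p222798 p223239 p223402 p223410 p218146 p219284 p219461 p219850 p222172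
  p224056 p224237
* A12-I.X4 (S12i v1.1): `HistoryRealiseCellsRunPinnedT3bP` `HistoryRealiseCellsRunHeadlineT3bP`
  `HistoryRealiseCellsRunPinned` `HistoryFlowProfileLevel` `HistoryRealiseCellsRunApexT3b` `HistoryConstantsSlackT3bP`
  `HistoryRealiseCellsRunHeadlinePos` — p224056 p224237 p223239 p223694 p223186 p223410 p219850 p223402 p224272
* A12-I.L (S12l): `HistoryRealiseCellsRunHeadlinePos` `HistoryRealiseCellsRunHeadline` `HistoryConstantsSlackT3bP` —
  p224272 p224237 p224979
* A12-I.S (S12m): `HistoryFlowProfileRoot` `HistoryPayThresholdRoot` `HistoryExitLE` — p224771 p225123 p232877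
* W1 (ROAD W-RP-VAR): `HistoryChessboardDressing` — p218546
* W2 (ROAD W-RP-VAR): `HistoryChessboardDensity` — p218647
* W3 (ROAD W-RP-VAR): `HistoryRPTensor` `HistoryRPBase` `HistoryRPDeterministic` `HistoryChessboardEventsCutoff`
  `HistoryRPBlocks` `HistoryRPBlocksWilson` `HistoryRPHalfTorus` `HistoryRPAveraging` `HistoryRPAveragingCuts`
  `HistoryRPGibbsState` `HistoryRPGibbs` `HistoryRPTwoLevel` `HistoryChessboardRP` `HistoryRPTower`
  `HistoryRPGibbsCuts` `HistoryRPTwoLevelCuts` `HistoryRPTowerLaw` `HistoryRPTowerCuts` `HistoryRPTowerColumns`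
  `HistoryRPTowerColumnSigma` `HistoryRPTowerColumnCubes` `HistoryRPTowerTemplates` `HistoryRPTowerCells`
  `HistoryRPTowerColumnBox` `HistoryRPTowerUniform` `HistoryChessboardEventsTemplates` `HistoryRPExtension` — p218578
  p219873 p220139 p220032 p220515 p220651 p221479 p222069 p221545 p222370 p222539 p222547 p222804 p222902 p223229
  p223274 p223621 p225683 p225948 p226427 p226647 p226891 p227195 p227495 p227811 p223877 p224104
* W4 (ROAD W-RP-VAR): `HistoryChessboardAssembly` `HistoryChessboardEvents` `HistoryRPExtension`
  `HistoryChessboardEventsCutoff` `HistoryChessboardEventsTower` `CountSeamJunction` `HistoryRPTowerCuts`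
  `HistoryChessboardEventsSplit` `HistoryChessboardEventsCubes` `HistoryChessboardEventsCubeSites`
  `HistoryChessboardLabels` `HistoryChessboardLabelsCubes` `HistoryChessboardLabelsGibbs`
  `HistoryChessboardLabelsReader` `HistoryChessboardLabelsGibbsReader` — p218970 p219197 p219478 p220032 p224832
  p225060 p225762 p226093 p226427 p228470 p228707 p228817 p228927 p229271
* W5 (ROAD W-RP-VAR): `HistoryChessboardRP` — p218967
* W4b (ROAD W-RP-VAR): `HistoryChessboardEvents` — p219197
* W4c (ROAD W-RP): `HistoryChessboardEventsSplit` `HistoryChessboardEventsTower` `HistoryChessboardEventsCubes`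
  `HistoryChessboardEventsCubeSites` — p224832 p225060 p225762 p226093
* W3b (ROAD W-RP-VAR): `HistoryRPExtension` — p219478
* W3c (ROAD W-RP-VAR): `HistoryRPBase` — p219873
* W3d (ROAD W-RP-VAR): `HistoryRPDeterministic` — p220139
* W3e (ROAD W-RP-VAR): `HistoryRPBlocks` `HistoryRPBlocksWilson` — p220515 p220651
* W3f (ROAD W-RP): `HistoryRPHalfTorus` `HistoryRPAveraging` — p221479 p222069
* W3g (ROAD W-RP): `HistoryRPAveragingCuts` — p221545
* W3h (ROAD W-RP): `HistoryRPGibbsState` `HistoryRPGibbs` — p222370 p222539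
* W3i (ROAD W-RP): `HistoryRPTwoLevel` — p222547
* W3j (ROAD W-RP): `HistoryRPTower` — p222804
* W3h′ (ROAD W-RP): `HistoryRPGibbsCuts` — p222902
* W3k (ROAD W-RP): `HistoryRPTwoLevelCuts` — p223229
* W3l (ROAD W-RP): `HistoryRPTowerLaw` `HistoryRPTowerCuts` — p223621
* W3m (ROAD W-RP): `HistoryRPTowerCuts` `HistoryRPTowerCells` — p223877 p224104
* W6 (ROAD W-RP): `HistoryChessboardPinned` `HistoryChessboardApex` `HistoryChessboardHeadline`
  `HistoryChessboardEndWitness` `HistoryChessboardApexWitness` `HistoryChessboardAssembly`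
  `HistoryRealiseCellsRunApexT3b` `HistoryChessboardEventsCutoff` — p225499 p225502 p225792 p225144 p226019 p224237
  p220032 p218970 p223239 p226638
* W-E1 (ROAD W-RP): `HistoryChessboardTowerRepr` `HistoryChessboardEventsTower` — p226638 p225060 p225502 p220032
* W7 (ROAD W-RP): `HistoryChessboardGibbsSide` `HistoryChessboardTowerRepr` `HistoryChessboardEventsCubes`
  `HistoryChessboardGibbs` `HistoryChessboardHeadline` `HistoryChessboardGibbsWitness` `HistoryChessboardApexWitness`
  — p227394 p227659 p225792 p227970 p224237 p225502 p229713
* S12n (COUNT ROAD): `HistoryJoinsPlacedTwin` `HistoryJoinsSupTorus` `HistorySiblingEntropy` — p219354 p224237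
* S12o (COUNT ROAD): `HistoryJoinsBudgetPivot` `HistoryThetaConcaveNumerals` `HistoryConcaveJensen`
  `HistoryJoinsEntropyBudgetPivot` `HistoryJoinsPlacedOmega` `HistoryJoinsEndConcave` `HistoryJoinsPlacedOmegaSharp`
  `HistoryAssemblyMultInstanceTwin` `HistoryJoinsPlacedEndConcave` `HistoryRealiseCellsRunMultEndPTwin`
  `HistoryJoinsPlacedLawsConcave` `HistoryRealiseCellsRunMultEndPDTwin` `HistoryJoinsPlacedTwinConcave`
  `HistoryRealiseCellsRunPinnedT3bPTwin` `HistoryAssemblyMultInstanceConcave` `HistoryRealiseCellsRunHeadlineT3bPTwin`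
  `HistoryRealiseCellsRunHeadlineT3bPc` `HistoryJoinsSupTorus` `HistorySiblingEntropy` `HistoryAssemblyMultInstance`
  `HistoryJoinsPlacedTwin` `HistoryJoinsEntropyBudget` `HistoryRealiseCellsRunApexT3b` `HistoryConstantsSlackT3bP`
  `HistoryRealiseCellsRunHeadlineT3bP` — p228000 p228231 p228273 p228345 p228504 p228622 p228840 p228913 p228974
  p229230 p229377 p229526 p223694 p229695 p219354 p229941 p230007 p230092 p230345 p224237 p231379 p232442 p214234
  p223544 p221213 p232166
* S12p (COUNT ROAD): `HistoryZoneMassLawFactor` `HistoryZoneMassClusterSat` — p230989 p231349 p214316 p217345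
* S12q (COUNT ROAD): `HistoryRealiseCellsRunWindowT3bPc` `HistoryWindowNumerals` `HistoryThetaConcaveNumerals`
  `HistoryRealiseCellsRunWindowT3bPTwin` `HistoryRealiseCellsRunPinnedT3bP` — p232166 p224056 p225123 p232877 p233003
  p229941 p228231 p230007
* S10∕S10b: `HistoryConstantsExist` `HistoryConstantsExistTH` — p207685 p207928 p208727
* W-LAB: `HistoryChessboardLabels` `HistoryChessboardLabelsCubes` `HistoryChessboardLabelsGibbs`
  `HistoryChessboardLabelsReader` `HistoryChessboardLabelsGibbsReader` `HistoryChessboardLabelsPattern`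
  `HistoryChessboardReaderWitness` `HistoryChessboardReaderCells` `HistoryChessboardReaderWitnessToy`
  `HistoryChessboardSmallFieldReader` — p228470 p228707 p228817 p228927 p229271 p229609 p230008 p230318 p230999
  p230728 p229713 p231961
* W-2T: `HistoryChessboardGibbsCells` `HistoryChessboardGibbs` `HistoryChessboardGibbsCellsRoad`
  `HistoryChessboardGibbsCellsTemplates` `HistoryChessboardGibbsCollapse` `HistoryChessboardGibbsCellsWitness` —
  p229554 p227659 p227970 p229916 p230048 p230222 p230744
* S12k: `HistoryConstantsSlackT3b` `HistoryConstantsSlackT3bP` — p223209 p223575 p223753 p224237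
* (not attached to a node in either table; helper ∕ supplier modules of the rows above, in the tree):
  `CountThresholdExit` `CountThresholdShapeFree` `CountThresholdUniform` `CountWitness` `CountWitnessRun`
  `HistoryAssemblyZoneH` `HistoryChessboardPlaquetteBox` `HistoryChessboardPlaquetteReader`
  `HistoryConstantsExistTagged` `HistoryConstantsSlackRecord` `HistoryLevelsClamp` `HistorySocket`
  `HistorySocketTagged` `HistorySocketWitness` `HistoryZoneEvolveSaturate` `HistoryZonesOrbitPedigree`
  `HistoryZonesOrbitRealise`
* LI (this file): `Spine/NE7b/LeafIndex` — the import apex ∕ leaf index (R-OWNER-24-1 (D), GO R-OWNER-24-2 (A))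
* v1.1 ADDENDUM (mirror v2.55; the two rows landed after v1 — both now IMPORTED, name-checked in §4):
  S12r (COUNT ROAD, «THE INFRARED FACTOR DISPLAYED»): `HistoryAssemblyTreesPayRoot` `HistoryAssemblyRealiseRunMultPPayRoot`
  `HistoryRealiseCellsRunWindowT3bPcPayRoot` — p234299 p234727 p235130;
  W-LAB 11 (ROAD W-RP; supersedes the «not attached» listing of 11a∕11b above): `HistoryChessboardPlaquetteBox`
  `HistoryChessboardPlaquetteReader` `HistoryChessboardPlaquetteReaderBonds` — p233622 p234088 p234543

## §1 WHAT THE NAME CHECKS PIN (tree head at filing)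
TARGET `T4WeightBudget.RelWeightBound`; EXITS `CountThresholdExit.relWeightBound_lateMergers_of_irThreshold` (R1, D := 0,
Δ := 1) ∕ `HistoryExitLE.relWeightBound_canon_of_irThresholdLE`; END OF RECORD v3.1′
`HistoryRealiseCellsRunMultEndPD.hybridNE7_of_realisedDomainsRun_printedT3bPD` (p223694); PINNED END
`HistoryRealiseCellsRunPinnedT3bP.hybridNE7_of_realisedDomainsRun_pinnedT3bPD` (p224056); HEADLINE OF RECORD
`HistoryRealiseCellsRunHeadlineT3bP.continuumYM4Torus_of_countRoadT3bP_fsc` (p224237); its re-proof through the concave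
class-linear constant `HistoryRealiseCellsRunHeadlineT3bPc` (p231379 ∕ v1.1 p232442); THE COUPLING WINDOW DISPLAYED
`HistoryRealiseCellsRunWindowT3bPc.hybridNE7_of_realisedDomainsRun_windowT3bPDc` (p232166); W-ROAD HEADLINE
`HistoryChessboardHeadline.continuumYM4Torus_of_chessboardRoad_fsc` (p225792); its Θ₀-uniform twin
`HistoryRealiseCellsRunWindowT3bPTwin.hybridNE7_of_realisedDomainsRun_windowT3bPD_of_twin` (p233632); census numerals (tree-free,
NOT imported, named only) `HistoryThetaConcaveNumerals.thetaJc_le` (p230007) ∕ `HistoryWindowNumerals.window23_Jc` (p233003); NEGATIVES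
`T4BadClassBooking.not_relWeightBound_of_saturated` (a saturated class admits no `RelWeightBound`) and
`T4PersistentHistoryCount.allAges_birthBudget_unbounded` (the all-ages absolute birth budget diverges with the cutoff).
v1.1 (§4): THE COUPLING WINDOW IN CLOSED FORM IN BOTH FACTORS `HistoryRealiseCellsRunWindowT3bPcPayRoot.hybridNE7_of_realisedDomainsRun_
windowT3bPDcPayRoot` (p235130) and its re-plugged END chain `HistoryAssemblyTreesPayRoot.hybridNE7_of_treeBinders_canonPayRoot`
(p234299) ∕ `HistoryAssemblyRealiseRunMultPPayRoot.hybridNE7_of_realisedDomainsRun_printedMultPPayRoot` (p234727); W-LAB file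
11's plaquette reader `HistoryChessboardPlaquetteReader.plaqUniform` ∕ `plaqReader` (p234088) over `HistoryChessboardPlaquetteBox.
cplaq` (p233622) and the bond ⇒ plaquette junction `HistoryChessboardPlaquetteReaderBonds.readerCellSide_plaqReader_of_bonds` (p234543).
-/

namespace Summit.QuantumFields.BalabanUV.T4Continuum.Spine.NE7b.LeafIndex

open Literature.MathematicalPhysics.QuantumFieldTheory.Balaban1983to89
open Summit.QuantumFields.BalabanUV.T4Continuum

universe u_1 u v w

/-! ## §2 Name checks (each `example := @<decl>` elaborates iff the declaration exists under that name) -/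

/-- TARGET shape: NE7b's binder `T4WeightBudget.RelWeightBound`. -/
example := @T4WeightBudget.RelWeightBound

/-- R1 EXIT (TH, D := 0 specialisable): `CountThresholdExit.relWeightBound_lateMergers_of_irThreshold`. -/
example := @CountThresholdExit.relWeightBound_lateMergers_of_irThreshold

/-- LE EXIT (no renewal-at-reach clause): `HistoryExitLE.relWeightBound_canon_of_irThresholdLE`. -/
example := @HistoryExitLE.relWeightBound_canon_of_irThresholdLE

/-- END OF RECORD v3.1′ (p223694). -/
example := @HistoryRealiseCellsRunMultEndPD.hybridNE7_of_realisedDomainsRun_printedT3bPD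

/-- PINNED END (p224056). -/
example := @HistoryRealiseCellsRunPinnedT3bP.hybridNE7_of_realisedDomainsRun_pinnedT3bPD

/-- HEADLINE OF RECORD (p224237): `ContinuumYM4Torus D` ⇐ (B) ∧ BetaPertHyp ∧ constants side ∧ ForSmallCouplings[…]. -/
example := @HistoryRealiseCellsRunHeadlineT3bP.continuumYM4Torus_of_countRoadT3bP_fsc

/-- the concave re-proof's supplier (p231379): the `twin` field at `Θ₀ := ΘJc` from BetaPertHyp along tuned runs. -/
example := @HistoryRealiseCellsRunHeadlineT3bPc.forSmallCouplings_twinConcave_of_betaPertHyp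

/-- THE COUPLING WINDOW DISPLAYED (p232166). -/
example := @HistoryRealiseCellsRunWindowT3bPc.hybridNE7_of_realisedDomainsRun_windowT3bPDc

/-- W-ROAD HEADLINE (p225792). -/
example := @HistoryChessboardHeadline.continuumYM4Torus_of_chessboardRoad_fsc

/-- THE COUPLING WINDOW DISPLAYED, UNIFORM IN THE TWIN CONSTANT Θ₀ (p233632). -/
example := @HistoryRealiseCellsRunWindowT3bPTwin.hybridNE7_of_realisedDomainsRun_windowT3bPD_of_twin

/-- NEGATIVE: a saturated class admits no `RelWeightBound` (Literature `T4BadClassBooking`). -/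
example := @T4BadClassBooking.not_relWeightBound_of_saturated

/-- NEGATIVE: the all-ages absolute birth budget is unbounded in the cutoff (Literature `T4PersistentHistoryCount` §12). -/
example := @T4PersistentHistoryCount.allAges_birthBudget_unbounded

/-! ## §3 Junctions of record as NAMED statements (bookkeeping BY NAME between the tree's own Props; each is a new
implication ∕ conjunction whose proof is the composition already landed as an `example` elsewhere — nothing re-derived,
nothing printed asserted, no binder discharged) -/

/-- **THE WINDOW END IMPLIES THE PINNED END OF RECORD** (p232166 §2's fidelity `example`, as a named implication):
S12q's statement with the coupling window DISPLAYED gives v1.1's pinned `HistoryRealiseCellsRunPinnedT3bP.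
hybridNE7_of_realisedDomainsRun_pinnedT3bPD` (the `∃ g₁`-form the headline of record p224237 is built on) with
`g₁ :=` the displayed window. [folklore] -/
theorem pinned_of_window :
    type_of% @HistoryRealiseCellsRunWindowT3bPc.hybridNE7_of_realisedDomainsRun_windowT3bPDc.{u_1, u, v, w} →
    type_of% @HistoryRealiseCellsRunPinnedT3bP.hybridNE7_of_realisedDomainsRun_pinnedT3bPD.{u_1, u, v, w} :=
  fun W => fun D hB hβ hsign _ _ _ _ h hμ d n hκ₁ hE₀ hA₀ hβ₀ hLβ hn₁ hn _ hθ hslack hE₂ hE₃ _ hsS hsmall _ hθc0 hθc1 hθcs => by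
    obtain ⟨γ₁, hγ₁, H⟩ := W D hB hβ hsign h hμ d n hκ₁ hE₀ hA₀ hβ₀ hLβ hn₁ hn hθ hslack hE₂ hE₃ hsS hsmall hθc0 hθc1 hθcs
    exact ⟨γ₁, hγ₁, fun γ hγ hγle => ⟨_, lt_min (lt_min one_pos (Real.exp_pos _)) (Real.exp_pos _),
      fun g hg hgle => H γ hγ hγle g hg hgle⟩⟩

/-- **THE Θ₀-UNIFORM WINDOW END IMPLIES THE Θ₀-UNIFORM PINNED TWIN** (p233632 (F1), as a named implication): row S12o
(iv)'s `HistoryRealiseCellsRunPinnedT3bPTwin.hybridNE7_of_realisedDomainsRun_pinnedT3bPD_of_twin` (p229941) with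
`g₁ := W(Θ₀)`. [folklore] -/
theorem pinnedTwin_of_windowTwin :
    type_of% @HistoryRealiseCellsRunWindowT3bPTwin.hybridNE7_of_realisedDomainsRun_windowT3bPD_of_twin.{u_1, u, v, w} →
    type_of% @HistoryRealiseCellsRunPinnedT3bPTwin.hybridNE7_of_realisedDomainsRun_pinnedT3bPD_of_twin.{u_1, u, v, w} :=
  fun W => fun D hB hβ hsign _ _ _ _ h hμ d n hκ₁ hE₀ hA₀ hβ₀ hLβ hn₁ hn _ hθ hslack Θ₀ => by
    obtain ⟨γ₁, hγ₁, H⟩ := W D hB hβ hsign h hμ d n hκ₁ hE₀ hA₀ hβ₀ hLβ hn₁ hn hθ hslack Θ₀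
    exact ⟨γ₁, hγ₁, fun γ hγ hγle => ⟨_, lt_min (lt_min one_pos (Real.exp_pos _)) (Real.exp_pos _),
      fun g hg hgle => H γ hγ hγle g hg hgle⟩⟩

/-- **THE TWO BY-NAME HEADLINES OF ROW NE7b, JOINTLY** (the COUNT road's headline of record p224237 and the W-road's
p225792): both conclude `ContinuumYM4Torus D` — each CONDITIONAL on (B) ∧ BetaPertHyp ∧ its displayed witness family;
nothing of H3 ∕ (B) ∕ BetaPertHyp ∕ NE7c ∕ NE7 ∕ rates discharged; NE7b NOT proved; 0∕9. [folklore] -/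
theorem headlines_of_record :
    (type_of% @HistoryRealiseCellsRunHeadlineT3bP.continuumYM4Torus_of_countRoadT3bP_fsc) ∧
    (type_of% @HistoryChessboardHeadline.continuumYM4Torus_of_chessboardRoad_fsc) :=
  ⟨@HistoryRealiseCellsRunHeadlineT3bP.continuumYM4Torus_of_countRoadT3bP_fsc,
   @HistoryChessboardHeadline.continuumYM4Torus_of_chessboardRoad_fsc⟩

/-! ## §4 (v1.1, APPENDED) The final in-flight set landed after v1: name checks for row S12r and W-LAB file 11, and ONE
junction of §3's kind (bookkeeping BY NAME between the tree's own Props; nothing re-derived ∕ printed asserted ∕ discharged) -/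

/-- S12r (A) (p234299): the tree-binder END re-plugged at the explicit pay threshold. -/
example := @HistoryAssemblyTreesPayRoot.hybridNE7_of_treeBinders_canonPayRoot
/-- S12r (B) (p234727): the realised-run multiplicity-profile socket at the explicit pay threshold. -/
example := @HistoryAssemblyRealiseRunMultPPayRoot.hybridNE7_of_realisedDomainsRun_printedMultPPayRoot
/-- S12r (C) (p235130): THE COUPLING WINDOW DISPLAYED IN CLOSED FORM IN BOTH FACTORS (explicit pay-threshold road). -/
example := @HistoryRealiseCellsRunWindowT3bPcPayRoot.hybridNE7_of_realisedDomainsRun_windowT3bPDcPayRoot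
/-- W-LAB 11a (p233622): the centred reflection of a plaquette (data for the reader's symmetry clause). -/
example := @HistoryChessboardPlaquetteBox.cplaq
/-- W-LAB 11b (p234088): the uniform small-plaquette event on the box, level by level (Set-valued data). -/
example := @HistoryChessboardPlaquetteReader.plaqUniform
/-- W-LAB 11b (p234088): the plaquette reader `Tower → Bool` (noncomputable: classical `decide` of membership). -/
noncomputable example := @HistoryChessboardPlaquetteReader.plaqReader
/-- W-LAB 11c (p234543): bond-small at `ε` ⇒ the plaquette reader's `ReaderCellSide` at `4ε`, same rate. -/
example := @HistoryChessboardPlaquetteReaderBonds.readerCellSide_plaqReader_of_bonds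

/-- **THE EXPLICIT-THRESHOLD WINDOW END IMPLIES THE PINNED END OF RECORD** (v1.1; the S12r analogue of §3's
`pinned_of_window`, SAME λ-term): S12r (C)'s statement — S12q's p232166 with the single token `irThresholdTLE ↦
payThresholdRoot` inside the displayed window's first factor, every binder otherwise identical — gives v1.1's pinned
`HistoryRealiseCellsRunPinnedT3bP.hybridNE7_of_realisedDomainsRun_pinnedT3bPD` (p224056, the `∃ g₁`-form the headline
of record p224237 is built on) with `g₁ :=` the explicit window `min (min 1 e^{−payThresholdRoot∕2}) (e^{−(x_root+1)∕2})`.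
So BOTH displayed windows (named threshold p232166, explicit threshold p235130) specialise the one pinned END; the two
window statements themselves remain incomparable in the kernel.  Nothing of H3 ∕ (B) ∕ BetaPertHyp ∕ NE7c ∕ NE7 ∕
rates discharged; NE7b NOT proved; 0∕9. [folklore] -/
theorem pinned_of_windowPayRoot :
    type_of% @HistoryRealiseCellsRunWindowT3bPcPayRoot.hybridNE7_of_realisedDomainsRun_windowT3bPDcPayRoot.{u_1, u, v, w} →
    type_of% @HistoryRealiseCellsRunPinnedT3bP.hybridNE7_of_realisedDomainsRun_pinnedT3bPD.{u_1, u, v, w} :=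
  fun W => fun D hB hβ hsign _ _ _ _ h hμ d n hκ₁ hE₀ hA₀ hβ₀ hLβ hn₁ hn _ hθ hslack hE₂ hE₃ _ hsS hsmall _ hθc0 hθc1 hθcs => by
    obtain ⟨γ₁, hγ₁, H⟩ := W D hB hβ hsign h hμ d n hκ₁ hE₀ hA₀ hβ₀ hLβ hn₁ hn hθ hslack hE₂ hE₃ hsS hsmall hθc0 hθc1 hθcs
    exact ⟨γ₁, hγ₁, fun γ hγ hγle => ⟨_, lt_min (lt_min one_pos (Real.exp_pos _)) (Real.exp_pos _),
      fun g hg hgle => H γ hγ hγle g hg hgle⟩⟩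

end Summit.QuantumFields.BalabanUV.T4Continuum.Spine.NE7b.LeafIndex
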